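import Summits.AtomisticToContinuum.BoseEinsteinCondensation.Theorems.BECInfDivCoherenceGridInfDivCoherenceNegLevyMoment
import Summits.AtomisticToContinuum.BoseEinsteinCondensation.Theorems.BECInfDivCoherenceGridInfDivCoherenceGridAverageFromMoments
import HarnessLib

/-!
# Route `BECInfDivCoherence`, crux `GridInfDivCoherence` (stmt-AtomisticToContinuum-9114): the bootstrap step
# "more than half condensed on the grid ⇒ almost fully condensed", from the `(−1)`-moment bound alone

Support file (`--supports stmt-AtomisticToContinuum-9114`; lead c2). It makes precise the lead's re-plan
proposal for the route (handback note on the crux item): the pointwise sign condition of the crux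
`GridInfDivCoherence` can be traded for the BOOTSTRAP hypothesis "grid average of the coherence `≥ 1/2 + μ`",
because the negative Lévy mass is then controlled by the kinetic f-sum (`negLevyMoment_coherence_le`), and
the single-state glue `gridAverage_exp_lower_bound` turns the three Lévy moments into a lower bound on the
grid average. Result `bootstrap_gridAverage`: under kinetic energy `≤ T` (`h²T ≤ 1`), grid average
`≥ 1/2 + μ` and `(−1)`-moment `≤ C` (crux `LevyNegativeMoment`), the grid average is
`≥ exp(−(π²T(1+6μ)/(48μs²) + 2sC/3))` for every `s > 0`, i.e. `≥ 1 − O((ρa)^{1/3})` at low density.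
References: Berg–Christensen–Ressel (1984) Ch. 3–4; Lieb–Seiringer–Solovej–Yngvason (2005) §1.2.
-/

noncomputable section

namespace Summit.AtomisticToContinuum.BoseEinsteinCondensation.Theorems

open Finset MeasureTheory InfDivGlue
open Literature.MathematicalPhysics.QuantumManyBody.BoseGas
open scoped ENNReal ComplexConjugate

/-- **Bootstrap step for condensation on the torus grid** (route `BECInfDivCoherence`, crux vocabulary).
Let `Ψ` be a periodic trial state of `N` bosons on the torus of side `L`, `i` a particle whose kinetic
energy `Σ_a ∫_{cell^N} |∂_{i,a}Ψ|²` is `≤ T`, `m ≥ 2` a grid size with `h = L/m` and `h²T ≤ 1`, `G` the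
translation coherence and `ν_q` its discrete Lévy weights. If the grid average `g₀ = m⁻³ Σ_j G(hj)` is
`≥ 1/2 + μ` (`μ > 0`) and the positive Lévy mass has `(−1)`-moment `Σ_{q≠0} ν_q⁺/|k_q| ≤ C`
(`|k_q| = (2π/L)|q̄|`), then for every `s > 0`, `g₀ ≥ exp(−(π² T (1 + 6μ)/(48 μ s²) + 2 s C/3))`:
`negLevyMoment_coherence_le` supplies `G > 0` at the nodes and the negative-mass bound
`Σ_{q≠0} ν⁻λ ≤ ((1−g₀)/(2g₀−1))(h²/2)T ≤ ((1−2μ)/(8μ)) h²T`, and `gridAverage_exp_lower_bound` does the rest.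
With `T ≲ ρa` and `s := T^{1/3}` the exponent is `O((ρa)^{1/3}(1 + C))`: at low density "more than half
condensed on the grid" upgrades itself to "almost fully condensed", given only the `(−1)`-moment bound
(crux `LevyNegativeMoment`) — no sign condition on the Lévy weights.
[BergChristensenRessel1984 Ch. 3–4; LiebSeiringerSolovejYngvason2005 §1.2] -/
theorem bootstrap_gridAverage :
    ∀ (N : ℕ) (L : ℝ), 0 < L → ∀ (m : ℕ) [NeZero m], 2 ≤ m →
    ∀ (Ψ : PeriodicTrialState N L) (i : Fin N) (G : EuclideanSpace ℝ (Fin 3) → ℝ),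
    (∀ r, G r = (∫ X in cellN N L, conj (Ψ.ψ (Function.update X i (X i + r))) * Ψ.ψ X).re) →
    ∀ (T μ C s : ℝ), 0 < μ → 0 < s → 0 ≤ T → (L / m) ^ 2 * T ≤ 1 →
    (∑ a : Fin 3, ∫⁻ X in cellN N L,
      (‖fderiv ℝ Ψ.ψ X (Pi.single i (EuclideanSpace.single a (1 : ℝ)))‖₊ : ℝ≥0∞) ^ 2) ≤
        ENNReal.ofReal T →
    1 / 2 + μ ≤ (∑ j : Fin 3 → Fin m, G (latticeVec (L / m) fun k => ((j k : ℕ) : ℤ))) / (m : ℝ) ^ 3 →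
    (∑ q : Fin 3 → Fin m with (∃ k, (q k : ℕ) ≠ 0),
      max ((∑ j : Fin 3 → Fin m, Real.log (G (latticeVec (L / m) fun k => ((j k : ℕ) : ℤ))) *
          Real.cos (2 * Real.pi * (∑ k, ((q k : ℕ) : ℝ) * ((j k : ℕ) : ℝ)) / m)) / (m : ℝ) ^ 3) 0 /
        (2 * Real.pi / L * Real.sqrt (∑ k, ((min (q k : ℕ) (m - (q k : ℕ)) : ℕ) : ℝ) ^ 2))) ≤ C →
    Real.exp (-(Real.pi ^ 2 * T * (1 + 6 * μ) / (48 * μ * s ^ 2) + 2 * s * C / 3)) ≤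
      (∑ j : Fin 3 → Fin m, G (latticeVec (L / m) fun k => ((j k : ℕ) : ℤ))) / (m : ℝ) ^ 3 := by
  intro N L hL m _ hm Ψ i G hGdef T μ C s hμ hs hT hsmall hkin hhalf hC
  have hm0 : 0 < m := by omega
  have hmpos : (0 : ℝ) < m := by exact_mod_cast hm0
  have hhpos : 0 < L / m := div_pos hL hmpos
  -- kinetic slices are finite and sum to `≤ T`
  have hτfin : ∀ a : Fin 3, (∫⁻ X in cellN N L,
      (‖fderiv ℝ Ψ.ψ X (Pi.single i (EuclideanSpace.single a (1 : ℝ)))‖₊ : ℝ≥0∞) ^ 2) ≠ ⊤ := fun a =>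
    ne_top_of_le_ne_top ENNReal.ofReal_ne_top
      ((Finset.single_le_sum (f := fun a : Fin 3 => ∫⁻ X in cellN N L,
        (‖fderiv ℝ Ψ.ψ X (Pi.single i (EuclideanSpace.single a (1 : ℝ)))‖₊ : ℝ≥0∞) ^ 2)
        (fun _ _ => zero_le) (Finset.mem_univ a)).trans hkin)
  have hτsum : ∑ a : Fin 3, (∫⁻ X in cellN N L,
      (‖fderiv ℝ Ψ.ψ X (Pi.single i (EuclideanSpace.single a (1 : ℝ)))‖₊ : ℝ≥0∞) ^ 2).toReal ≤ T := by
    rw [← ENNReal.toReal_sum fun a _ => hτfin a]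
    exact ENNReal.toReal_le_of_le_ofReal hT hkin
  -- the negative-mass bound from half-condensation
  set g0 : ℝ := (∑ j : Fin 3 → Fin m, G (latticeVec (L / m) fun k => ((j k : ℕ) : ℤ))) / (m : ℝ) ^ 3
    with hg0def
  have hg0half : 1 / 2 < g0 := by linarith
  obtain ⟨hGpos, hneg⟩ := negLevyMoment_coherence_le N L hL m hm Ψ i G hGdef hg0half hτfin
  have hGle : ∀ r, G r ≤ 1 := fun r => by rw [hGdef]; exact coh_le_one hL Ψ i r
  have hg0le : g0 ≤ 1 := by
    have hm3 : (0 : ℝ) < (m : ℝ) ^ 3 := by positivity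
    have : (∑ j : Fin 3 → Fin m, G (latticeVec (L / m) fun k => ((j k : ℕ) : ℤ))) ≤
        ∑ _j : Fin 3 → Fin m, (1 : ℝ) := Finset.sum_le_sum fun j _ => hGle _
    rw [Finset.sum_const, Finset.card_univ, Fintype.card_fun, Fintype.card_fin, Fintype.card_fin,
      nsmul_eq_mul, mul_one, Nat.cast_pow] at this
    rw [hg0def, div_le_one hm3]
    exact this
  set K : ℝ := (1 - g0) / (2 * g0 - 1) with hKdef
  have hK0 : 0 ≤ K := div_nonneg (by linarith) (by linarith)
  have hKle : K ≤ (1 - 2 * μ) / (4 * μ) := by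
    rw [hKdef, div_le_div_iff₀ (by linarith) (by positivity)]
    nlinarith
  set B : ℝ := K * ((L / m) ^ 2 / 2 * T) with hBdef
  have hneg' : (∑ q : Fin 3 → Fin m with (∃ k, (q k : ℕ) ≠ 0),
      max (-((∑ j : Fin 3 → Fin m, Real.log (G (latticeVec (L / m) fun k => ((j k : ℕ) : ℤ))) *
          Real.cos (2 * Real.pi * (∑ k, ((q k : ℕ) : ℝ) * ((j k : ℕ) : ℝ)) / m)) / (m : ℝ) ^ 3)) 0 *
        (∑ a, (1 - Real.cos (2 * Real.pi * ((q a : ℕ) : ℝ) / m)))) ≤ B :=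
    hneg.trans (mul_le_mul_of_nonneg_left (mul_le_mul_of_nonneg_left hτsum (by positivity)) hK0)
  have hcore := gridAverage_exp_lower_bound N L hL m hm Ψ i G hGdef T B C s hs hT hsmall hkin hGpos hneg' hC
  refine le_trans (Real.exp_le_exp.2 ?_) hcore
  -- compare the exponents: `T + B/h² ≤ T (1 + 6μ)/(8μ)`
  rw [neg_le_neg_iff]
  have hBh : B / (L / m) ^ 2 = K * T / 2 := by
    rw [hBdef]; field_simp
  have hTB : T + B / (L / m) ^ 2 ≤ T * (1 + 6 * μ) / (8 * μ) := by
    rw [hBh]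
    have h1 : K * T ≤ (1 - 2 * μ) / (4 * μ) * T := mul_le_mul_of_nonneg_right hKle hT
    have h2 : T * (1 + 6 * μ) / (8 * μ) = T + (1 - 2 * μ) / (4 * μ) * T / 2 := by
      field_simp; ring
    rw [h2]; linarith
  have h3 : Real.pi ^ 2 * (T + B / (L / m) ^ 2) / (6 * s ^ 2) ≤
      Real.pi ^ 2 * (T * (1 + 6 * μ) / (8 * μ)) / (6 * s ^ 2) := by
    gcongr
  have h4 : Real.pi ^ 2 * (T * (1 + 6 * μ) / (8 * μ)) / (6 * s ^ 2) =
      Real.pi ^ 2 * T * (1 + 6 * μ) / (48 * μ * s ^ 2) := by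
    field_simp; ring
  linarith

end Summit.AtomisticToContinuum.BoseEinsteinCondensation.Theorems

end
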